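import Summits.QuantumFields.BalabanUV.Beta.SymmetrisedStepJets
import Summits.QuantumFields.BalabanUV.Beta.PropagatorWoodburyFibreTarget

/-!
# `BalabanUV.Beta.SymmetrisedStepJetsUnits` — binder row D1, the (0.4) literal `JsB12Sym⁰`: ITS SECTORS AND THEIR N-POWERS, LEVEL BY LEVEL, DISPLAYED
# (the «units half» of road FP's N0b-S∕W question: ruling R-FP-38 (a) «YES PLEASE to the offered bookkeeping lemma … appended to `SymmetrisedStepJets`' successor»)

HONEST FRAMING (cell charter, verbatim): «discharging BetaPertH makes Balaban's UV stability UNCONDITIONAL — a real constructive-QFT result; it is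
NOT the continuum limit and NOT the Clay problem.»  HONEST DEPENDENCY: continuum YM on T⁴ ⇐ BetaPertH ∧ nine spine estimates (0/9 proved);
BetaPertH ⇐ (D1) ∧ (D4) ∧ CAP+tail; G-an2-4 gates asym, D1 and NE2/3/4.
DERIVED cell leaf (β sub-cell, BINDER-OWNERS row D1 OWNER `b2b-balaban-beta-an2`, gen 27; a CONSUMER REQUEST of road «FP» d1-p3-g10, journal 2026-08-21T06:48:54Z
(R-FP-38 (a)), under RULING R-D1-g27-3).  No statement of Bałaban's papers, no `[cite:]`, no `Prop` fact, no `def`.  Discharges NO binder; proves NO estimate; it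
UNFOLDS the literal of record `SymmetrisedStepJets.JsB12Sym0 hLc N tabs cΛ cB` (p253045) level by level into its SECTORS with their scalar coefficients at the pins
`(cE, cVH, cE₂) = (Lc⁴, −Lc⁸∕2, Lc⁸)`, and rewrites every step weight as an explicit power of `Lc` at `d + 1 = 4` — so that road FP's ledger units
`(c m, a m, b m, κ m)` of `FP/FineHessianNearLedgerCore.nearSplit_of_slice` (`hunits₁ : r·wg = c·b`, `hunits₂ : r·wg = κ·c²·a²`) can be READ OFF by the block-row
dictionary (road FP's (γ), an3's Q2) against numbers that are IN THE TREE, not chosen.  Which of FP's `P ∕ V ∕ W` equals which block row of which sector is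
(γ)'s business, NOT decided here.  NOT D1, NOT `BetaPertH`, NOT continuum, NOT Clay.
WHAT ([folklore] `rfl`-grade unfoldings + arithmetic on the tree's numerals):
§1 THE SECTORS. (S₀) `(JsB12Sym0 … 0).S κ u = Lc⁴ • wilsonA 3 κ u + (−Lc⁸∕2) • tabs.V κ u + cΛ • SLam Lc (lamCoeffOf KInv Lc) tabs.H κ u` — Wilson cubic (ff) sector
`Lc⁴`, first-order border sector `−Lc⁸∕2`, Λ-sector `cΛ`.  (Sⱼ₊₁) `(JsB12Sym0 … (j+1)).S κ u = (Lc⁴·wE 3 Lc (j+1)) • e3OfK Lc (Gsym Lc j) ((JsB12Sym0 … j).S) κ u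
+ (−Lc⁸∕2·wVH 3 Lc (j+1)) • tabs.V κ u + (cΛ·wΛ 3 Lc (j+1)) • SLam Lc (lamCoeffK (KInvStep Lc (j+1)) (E2 3 Lc (j+1)) Lc) tabs.H κ u` — cubic sector through the
symmetrised co-dressed step resolvent `Gsym Lc j`.  (W) `(JsB12Sym0 … j).W = W2SymOfK (Gsym Lc j) Lc (SpureSymOf … j) (tabs.M j) (T2RecOf … j) (M2Of 3 Lc tabs.mixFF j)`
with (T₀) `T2RecOf … 0 κ u κ′ u′ = Lc⁸ • wilsonW₂ 3 ((8N²)⁻¹ • wsym22 N) κ u κ′ u′ + cB • tabs.vh₂S κ u κ′ u′` (Wilson quartic (ff) sector `Lc⁸`, second-order border `cB`)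
and (Tⱼ₊₁) by `T2RecOf_succ` (quartic sector `Lc⁸·wV4 3 Lc (j+1)` through `e4OfKW`, border `cB·wB2 3 Lc (j+1)`).
§2 THE WEIGHTS AT `d + 1 = 4` AS POWERS OF `Lc`: `stepScale 3 Lc j = (Lc^j)⁵`, `wVH 3 Lc j = (Lc^j)¹⁰`, `wE 3 Lc j = (Lc^j)¹⁵`, `wΛ 3 Lc j = (Lc^j)²⁰`, `wV4 3 Lc j = (Lc^j)²⁰`,
`wB2 3 Lc j = (Lc^j)¹⁵`; the K-slot units of record `sfStep Lc j = Lc^j`, `smStep Lc j = Lc^{4j}` (`PropagatorWoodburyFibreTarget`; `HessKerDressedUnits.unitK`).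
§3 THE DISPLAYED TABLE for (γ): S cubic (ff) sector coefficient `Lc⁴·(Lc^j)¹⁵` (= `Lc⁴` at j = 0), S border `−(Lc⁸∕2)·(Lc^j)¹⁰`, W quartic (ff) sector `Lc⁸·(Lc^j)²⁰`
(= `Lc⁸` at j = 0), W border `cB·(Lc^j)¹⁵`, ℋ-column constant `cH j = ((Lc^j)⁵·Lc⁴)⁻¹` (`KernelWardHColumnSym`), K-units `(Lc^j, Lc^{4j})`.
Provenance: β sub-cell, unit beta-an2 gen 27, 2026-08-21 (v1); over `SymmetrisedStepJets`, the slot files, `BalabanStepJetsSucc`∕`BalabanStepW2` (weights),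
`PropagatorWoodburyFibreTarget` (K-units) BY NAME; no existing file touched.
-/

open Finset
open scoped BigOperators
open Literature.MathematicalPhysics.QuantumFieldTheory
open Literature.MathematicalPhysics.QuantumFieldTheory.Balaban1983to89
open Literature.MathematicalPhysics.QuantumFieldTheory.Balaban1983to89.Beta
open ExpKernelCalculus (MKer)
open OneStepResolventKernel (Fib KInv JetData)
open OneStepKernelFamily (KInvStep)
open BalabanStepJets (lamCoeffOf)
open BalabanStepJetsSucc (E2 lamCoeffK wE wVH wΛ)
open BalabanStepW2 (M2Of wV4 wB2)
open InterLevelTransport (SLam)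
open StepJetData (wilsonA)
open SecondOrderResponse (W2SymOfK)
open WilsonBiStencil (wilsonW₂)
open WilsonVertex2Sym (wsym22)
open Summit.QuantumFields.BalabanUV.Beta.BorderedHessian (stepScale)
open Summit.QuantumFields.BalabanUV.Beta.SpineRooted (e3OfK S0NOf SpureRecOf T2RecOf WrecOf T2RecOf_zero_level T2RecOf_succ)
open Summit.QuantumFields.BalabanUV.Beta.WardLocusRecursive (SrecOf SrecOf_zero SrecOf_succ)
open Summit.QuantumFields.BalabanUV.Beta.PropagatorWoodburyFibreTarget (sfStep smStep)
open Summit.QuantumFields.BalabanUV.Beta.SymmetrisedStepJets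

namespace Summit.QuantumFields.BalabanUV.Beta.SymmetrisedStepJetsUnits

noncomputable section

/-! ## §1 The sectors of the literal, level by level -/

section Sectors

variable {Lc : ℕ} [NeZero Lc]

/-- [folklore] **(S₀) LEVEL 0, FIRST ORDER**: Wilson cubic sector `Lc⁴`, border sector `−Lc⁸∕2`, Λ-sector `cΛ`. -/
theorem JsB12Sym0_S_zero (hLc : Odd Lc) (N : ℕ) (tabs : SymTables 3 Lc) (cΛ cB : ℝ) :
    (JsB12Sym0 hLc N tabs cΛ cB 0).S = fun κ u =>
      ((Lc : ℝ) ^ 4) • wilsonA 3 κ u + (-((Lc : ℝ) ^ 8 / 2)) • tabs.V κ u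
        + cΛ • SLam Lc (lamCoeffOf (KInv (N := Lc) (d := 3)) Lc) tabs.H κ u := by
  rw [JsB12Sym0_eq, JsSym0Of_S, SsymOf_eq, SrecOf_zero]
  rfl

/-- [folklore] **(Sⱼ₊₁) LEVEL `j+1`, FIRST ORDER**: cubic sector `Lc⁴·wE (j+1)` through `Gsym Lc j`, border `−Lc⁸∕2·wVH (j+1)`, Λ-sector `cΛ·wΛ (j+1)`. -/
theorem JsB12Sym0_S_succ (hLc : Odd Lc) (N : ℕ) (tabs : SymTables 3 Lc) (cΛ cB : ℝ) (j : ℕ) :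
    (JsB12Sym0 hLc N tabs cΛ cB (j + 1)).S = fun κ u =>
      ((Lc : ℝ) ^ 4 * wE 3 Lc (j + 1)) • e3OfK Lc (Gsym Lc j) (JsB12Sym0 hLc N tabs cΛ cB j).S κ u
        + (-((Lc : ℝ) ^ 8 / 2) * wVH 3 Lc (j + 1)) • tabs.V κ u
        + (cΛ * wΛ 3 Lc (j + 1)) • SLam Lc (lamCoeffK (KInvStep (d := 3) Lc (j + 1)) (E2 3 Lc (j + 1)) Lc) tabs.H κ u := by
  rw [JsB12Sym0_eq, JsSym0Of_S, JsSym0Of_S, SsymOf_eq, SrecOf_succ]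

/-- [folklore] **(W) EVERY LEVEL, SECOND ORDER**: the symmetrised second response over the slot tables at the pins. -/
theorem JsB12Sym0_W_eq (hLc : Odd Lc) (N : ℕ) (tabs : SymTables 3 Lc) (cΛ cB : ℝ) (j : ℕ) :
    (JsB12Sym0 hLc N tabs cΛ cB j).W =
      W2SymOfK (Gsym Lc j) Lc (SpureSymOf tabs ((Lc : ℝ) ^ 4) (-((Lc : ℝ) ^ 8 / 2)) cΛ j) (tabs.M j)
        (T2RecOf 3 Lc (Gsym Lc) (SpureSymOf tabs ((Lc : ℝ) ^ 4) (-((Lc : ℝ) ^ 8 / 2)) cΛ) tabs.M ((Lc : ℝ) ^ 8) cB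
          ((8 * (N : ℝ) ^ 2)⁻¹ • wsym22 N) tabs.vh₂S tabs.mixFF j)
        (M2Of 3 Lc tabs.mixFF j) := by
  rw [JsB12Sym0_eq, JsSym0Of_W]
  rfl

/-- [folklore] **(T₀) LEVEL 0, THE SECOND-ORDER FIELD TABLE**: Wilson quartic sector `Lc⁸`, second-order border `cB`. -/
theorem T2Rec_JsB12Sym_zero (N : ℕ) (tabs : SymTables 3 Lc) (cΛ cB : ℝ) :
    T2RecOf 3 Lc (Gsym Lc) (SpureSymOf tabs ((Lc : ℝ) ^ 4) (-((Lc : ℝ) ^ 8 / 2)) cΛ) tabs.M ((Lc : ℝ) ^ 8) cB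
        ((8 * (N : ℝ) ^ 2)⁻¹ • wsym22 N) tabs.vh₂S tabs.mixFF 0 =
      fun κ u κ' u' => ((Lc : ℝ) ^ 8) • wilsonW₂ 3 ((8 * (N : ℝ) ^ 2)⁻¹ • wsym22 N) κ u κ' u' + cB • tabs.vh₂S κ u κ' u' :=
  T2RecOf_zero_level _ _ _ _ _ _ _ _

end Sectors

/-! ## §2 The weights at `d + 1 = 4` as powers of `Lc`; the K-slot units of record -/

section Weights

variable {Lc : ℕ}

/-- [folklore] `stepScale 3 Lc j = (Lc^j)⁵`. -/
theorem stepScale_three (j : ℕ) : stepScale 3 Lc j = ((Lc : ℝ) ^ j) ^ 5 := rfl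

/-- [folklore] `wVH 3 Lc j = (Lc^j)¹⁰`. -/
theorem wVH_three (j : ℕ) : wVH 3 Lc j = ((Lc : ℝ) ^ j) ^ 10 := rfl

/-- [folklore] `wE 3 Lc j = (Lc^j)¹⁵`. -/
theorem wE_three (j : ℕ) : wE 3 Lc j = ((Lc : ℝ) ^ j) ^ 15 := rfl

/-- [folklore] `wΛ 3 Lc j = (Lc^j)²⁰`. -/
theorem wΛ_three (j : ℕ) : wΛ 3 Lc j = ((Lc : ℝ) ^ j) ^ 20 := rfl

/-- [folklore] `wV4 3 Lc j = (Lc^j)²⁰`. -/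
theorem wV4_three (j : ℕ) : wV4 3 Lc j = ((Lc : ℝ) ^ j) ^ 20 := rfl

/-- [folklore] `wB2 3 Lc j = (Lc^j)¹⁵`. -/
theorem wB2_three (j : ℕ) : wB2 3 Lc j = ((Lc : ℝ) ^ j) ^ 15 := rfl

/-- [folklore] The K-slot units of record (`HessKerDressedUnits.unitK (sfStep Lc j) (smStep Lc j)`): `sfStep Lc j = Lc^j`, `smStep Lc j = Lc^{4j}`. -/
theorem kUnits_three (j : ℕ) : sfStep Lc j = (Lc : ℝ) ^ j ∧ smStep Lc j = (Lc : ℝ) ^ (j * 4) := ⟨rfl, rfl⟩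

/-! ## §3 The displayed sector coefficients as powers of `Lc` (for road FP's (γ) block-row dictionary) -/

/-- [folklore] **THE FIRST-ORDER CUBIC (ff) SECTOR COEFFICIENT** at level `j+1`: `Lc⁴ · wE 3 Lc (j+1) = Lc⁴ · (Lc^{j+1})¹⁵`. -/
theorem cubicSector_coeff (j : ℕ) : (Lc : ℝ) ^ 4 * wE 3 Lc (j + 1) = (Lc : ℝ) ^ 4 * ((Lc : ℝ) ^ (j + 1)) ^ 15 := rfl

/-- [folklore] **THE FIRST-ORDER BORDER SECTOR COEFFICIENT** at level `j+1`: `−(Lc⁸∕2) · (Lc^{j+1})¹⁰`. -/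
theorem borderSector_coeff (j : ℕ) : -((Lc : ℝ) ^ 8 / 2) * wVH 3 Lc (j + 1) = -((Lc : ℝ) ^ 8 / 2) * ((Lc : ℝ) ^ (j + 1)) ^ 10 := rfl

/-- [folklore] **THE SECOND-ORDER QUARTIC (ff) SECTOR COEFFICIENT** at level `j+1`: `Lc⁸ · wV4 3 Lc (j+1) = Lc⁸ · (Lc^{j+1})²⁰`. -/
theorem quarticSector_coeff (j : ℕ) : (Lc : ℝ) ^ 8 * wV4 3 Lc (j + 1) = (Lc : ℝ) ^ 8 * ((Lc : ℝ) ^ (j + 1)) ^ 20 := rfl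

/-- [folklore] **THE ℋ-COLUMN WARD CONSTANT** of `KernelWardHColumnSym` at `d + 1 = 4`: `cH j = ((Lc^j)⁵ · Lc⁴)⁻¹`. -/
theorem cH_three (j : ℕ) : (stepScale 3 Lc j * (Lc : ℝ) ^ (3 + 1))⁻¹ = (((Lc : ℝ) ^ j) ^ 5 * (Lc : ℝ) ^ 4)⁻¹ := rfl

end Weights

end

end Summit.QuantumFields.BalabanUV.Beta.SymmetrisedStepJetsUnits
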